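import Mathlib
import Summits.NavierStokesRegularity.NavierStokesRegularity.Theorems.LerayQuarterDissipationFiniteDissipationLiouvilleWindowBlobProduction
import Summits.NavierStokesRegularity.NavierStokesRegularity.Theorems.PoloidalWindowDoorPoloidalWindowRigidityOneSlice
import Literature.Analysis.FluidPDE.BarkerPrange2020VorticityAlignmentTypeIHolds
import Literature.Analysis.FluidPDE.NSLocalLerayBackwardUniqueness
import Literature.Analysis.FluidPDE.CurlFreeLiouville
import HarnessLib

/-!
# Crux `FiniteDissipationLiouville` (stmt-NavierStokesRegularity-22144): DENSE EVERY-INSTANT FLOORS — the vorticity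
# and every directional derivative of the hypothetical singular profile have the full self-similar size somewhere in
# EVERY parabolic ball of the core, at EVERY instant

Theorems file of route `LerayQuarterDissipation` (lead prover g20; `--supports` the crux; companion of the g20 files
`…CaloricDefect(Windows)`, `…VorticityGradientFloor`). Navier–Stokes regularity is NOT proved by anything here; no summit is.

Leads g8/g9 recorded the vorticity and planarity floors on the similarity balls `B(0, r√(−t))` CENTRED ON THE AXIS
(clauses v13/v15 of the registered stub); lead g14 recorded the DENSE form (every sub-ball `B(x₀, r√(−t))`,
`‖x₀‖ ≤ ρ√(−t)`) for the unsteadiness. This file gives the dense every-instant form for the two first-order read-outs,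
from ONE-SLICE open-set kills of the tree (cell ns-regularity-ideate):

* `eq_zero_of_curl_eq_zero_on_open` — a member of the KNSS-gauge Type-I class one of whose slices is irrotational on a
  nonempty open set vanishes identically (Literature `curl_eq_zero_of_eqOn_open` + `eq_of_curl_eq_zero_of_isDivFree_of_bounded`
  + tree `…OneSlice.eq_zero_of_translate_eq_slice`); `eq_zero_of_fderiv_apply_eq_zero_on_open` — the same if one slice
  has `∂ₑW(s) = 0` on a nonempty open set for some `e ≠ 0` (identity theorem for `y ↦ D(W s)(y) e`, constancy along
  the lines `y + ℝe`, same kill);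
* **`curl_floor_dense` (+ `_envelope`)** — for all `C, K, ρ, r > 0` there is `δ > 0` such that for every SINGULAR member
  of `𝒟_{C,K}`, every `t < 0` and every centre `‖x₀‖ ≤ ρ√(−t)`, the ball `B(x₀, r√(−t))` contains a point with
  `(−t)‖curl W(t, x)‖ > δ`;
* **`fderiv_apply_floor_dense` (+ `_envelope`)** — the same with `(−t)‖D(W t)(x) e‖ > δ` for EVERY unit direction `e`
  (one `δ` for all directions: compactness of the unit sphere).

Proof: direct compactness at `t = −1` (KNSS limits across members `Compactness.seqLimit`, pointwise convergence of
values and gradients, convergent centres and directions, persistence of the singularity `persistent_singularity_seq`),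
then parabolic rescaling. Portrait clauses of the registered stub `stub_envelopeCriticalLiouville` (skeleton
`Lines/birth.lean`): the hypothetical singular profile is ROTATIONAL and NON-PLANAR in every direction on EVERY parabolic
sub-ball of its core at EVERY instant, by a definite dimensionless amount.

HONEST FRAMING. Compactness corollaries (ineffective `δ`) of kills already in the tree, about a HYPOTHETICAL object;
nothing is removed from the DSS wall (`∀ c>1 TypeIDSSLiouville c`, NECESSARY for the crux by `…Hardness`); the verdict
of the line is unchanged (FRONTIER). Nothing here bears on Navier–Stokes regularity.

References: Koch–Nadirashvili–Seregin–Šverák, Acta Math. 203 (2009) §4; P. G. Lemarié-Rieusset (2016), Thm 9.12; folklore.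
-/

noncomputable section

set_option linter.dupNamespace false

namespace Summit.NavierStokesRegularity.NavierStokesRegularity.Theorems.FiniteDissipationLiouville.DenseFloors

open MeasureTheory Set Filter Topology Metric InnerProductSpace Function Real
open scoped RealInnerProductSpace ContDiff ENNReal
open Literature.Analysis Literature.Analysis.FluidPDE
open Summit.NavierStokesRegularity.NavierStokesRegularity.Theorems
open Summit.NavierStokesRegularity.NavierStokesRegularity.Theorems.RecurrentReductionD
open Summit.NavierStokesRegularity.NavierStokesRegularity.Theorems.FiniteDissipationLiouville
open Summit.NavierStokesRegularity.NavierStokesRegularity.Theorems.FiniteDissipationLiouville.CrossFlow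
open Summit.NavierStokesRegularity.NavierStokesRegularity.Theorems.FiniteDissipationLiouville.Compactness
open Summit.NavierStokesRegularity.NavierStokesRegularity.Theorems.PoloidalWindowDoorPoloidalWindowRigidityOneSlice

variable {C : ℝ} {W : ℝ → EuclideanSpace ℝ (Fin 3) → EuclideanSpace ℝ (Fin 3)}

/-! ### The one-slice open-set kills -/

section Kill

/-- **A member of the class with an irrotational open patch on one slice is identically zero** (imported kill).
[cite: KochNadirashviliSereginSverak2009, §4 (arXiv:0709.3599 p. 8)] -/
theorem eq_zero_of_curl_eq_zero_on_open (hW : IsTypeIAncientMild C W) {s : ℝ} (hs : s < 0)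
    {U : Set (EuclideanSpace ℝ (Fin 3))} (hU : IsOpen U) (hne : U.Nonempty)
    (h : ∀ y ∈ U, curl (W s) y = 0) : ∀ t < 0, ∀ x, W t x = 0 := by
  have hA : AnalyticOnNhd ℝ (W s) univ := hW.analyticOnNhd_slice_univ hs
  have hcurl : ∀ y, curl (W s) y = 0 := curl_eq_zero_of_eqOn_open hA hU hne h
  have hconst : ∀ x y, W s x = W s y :=
    eq_of_curl_eq_zero_of_isDivFree_of_bounded hA.contDiff hcurl (hW.isDivFree hs)
      (fun x => hW.hasTypeITimeDecay s hs x)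
  have he : (EuclideanSpace.single 0 1 : EuclideanSpace ℝ (Fin 3)) ≠ 0 := fun h0 => by
    simpa using congrArg (fun w : EuclideanSpace ℝ (Fin 3) => w 0) h0
  exact eq_zero_of_translate_eq_slice hW.hasTypeITimeDecay hW.continuousOn_uncurry
    (fun _ _ hst ht x => hW.mild_eq_heatExtension hst ht x) (fun _ ht => hW.isDivFree ht) hs he
    fun y l => hconst _ _

/-- `y ↦ D(W s)(y) e` is real-analytic on `ℝ³`. [cite: LemarieRieusset2016, Thm. 9.12 (PDF p. 260)] -/
theorem analyticOnNhd_fderiv_apply_slice (hW : IsTypeIAncientMild C W) {s : ℝ} (hs : s < 0)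
    (e : EuclideanSpace ℝ (Fin 3)) : AnalyticOnNhd ℝ (fun y => fderiv ℝ (W s) y e) univ :=
  (ContinuousLinearMap.apply ℝ (EuclideanSpace ℝ (Fin 3)) e).comp_analyticOnNhd
    (hW.analyticOnNhd_slice_univ hs).fderiv

/-- **A member of the class with `∂ₑW(s) = 0` on an open patch of one slice (`e ≠ 0`) is identically zero.**
[cite: KochNadirashviliSereginSverak2009, §4 (arXiv:0709.3599 p. 8)] -/
theorem eq_zero_of_fderiv_apply_eq_zero_on_open (hW : IsTypeIAncientMild C W) {s : ℝ} (hs : s < 0)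
    {e : EuclideanSpace ℝ (Fin 3)} (he : e ≠ 0)
    {U : Set (EuclideanSpace ℝ (Fin 3))} (hU : IsOpen U) (hne : U.Nonempty)
    (h : ∀ y ∈ U, fderiv ℝ (W s) y e = 0) : ∀ t < 0, ∀ x, W t x = 0 := by
  obtain ⟨y₀, hy₀⟩ := hne
  have han := analyticOnNhd_fderiv_apply_slice hW hs e
  have hev : (fun y => fderiv ℝ (W s) y e) =ᶠ[𝓝 y₀] 0 :=
    Filter.eventually_of_mem (hU.mem_nhds hy₀) fun y hy => by simpa only [Pi.zero_apply] using h y hy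
  have hall : ∀ y, fderiv ℝ (W s) y e = 0 := fun y => by
    have := han.eqOn_zero_of_preconnected_of_eventuallyEq_zero isPreconnected_univ (mem_univ y₀) hev (mem_univ y)
    simpa using this
  have hdiff : Differentiable ℝ (W s) := fun y =>
    ((hW.analyticOnNhd_slice_univ hs) y (mem_univ y)).differentiableAt
  -- constancy along the lines `y + ℝ e`
  have hline : ∀ (y : EuclideanSpace ℝ (Fin 3)) (l : ℝ), W s (y + l • e) = W s y := by
    intro y l
    have hderiv : ∀ τ : ℝ, HasDerivAt (fun τ : ℝ => W s (y + τ • e)) (fderiv ℝ (W s) (y + τ • e) e) τ := by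
      intro τ
      have h1 : HasDerivAt (fun τ : ℝ => y + τ • e) e τ := by
        simpa using ((hasDerivAt_id τ).smul_const e).const_add y
      exact (hdiff (y + τ • e)).hasFDerivAt.comp_hasDerivAt τ h1
    have hconst := is_const_of_deriv_eq_zero (f := fun τ : ℝ => W s (y + τ • e))
      (fun τ => (hderiv τ).differentiableAt) (fun τ => by rw [(hderiv τ).deriv, hall]) l 0
    simpa using hconst
  exact eq_zero_of_translate_eq_slice hW.hasTypeITimeDecay hW.continuousOn_uncurry
    (fun _ _ hst ht x => hW.mild_eq_heatExtension hst ht x) (fun _ ht => hW.isDivFree ht) hs he hline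

end Kill

/-! ### The dense vorticity floor -/

section Vorticity

/-- **THE DENSE VORTICITY FLOOR AT THE UNIT SLICE (crux frame).** [cite: KochNadirashviliSereginSverak2009, §4 (arXiv:0709.3599 p. 8)] -/
theorem curl_floor_unit (C K : ℝ) {ρ r : ℝ} (hr : 0 < r) :
    ∃ δ : ℝ, 0 < δ ∧
    ∀ (V : ℝ → EuclideanSpace ℝ (Fin 3) → EuclideanSpace ℝ (Fin 3)), IsTypeIAncientMild C V →
      (∀ s : ℝ, s < 0 → ∫⁻ x, ‖fderiv ℝ (V s) x‖ₑ ^ 2 ≤ ENNReal.ofReal (K / Real.sqrt (-s))) →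
      (∀ r > 0, ∀ M : ℝ, ∃ t ∈ Ioo (-(r ^ 2)) (0 : ℝ),
        ∃ x ∈ ball (0 : EuclideanSpace ℝ (Fin 3)) r, M < ‖V t x‖) →
      ∀ x₀ : EuclideanSpace ℝ (Fin 3), ‖x₀‖ ≤ ρ →
        ∃ x ∈ ball x₀ r, δ < ‖curl (V (-1)) x‖ := by
  by_contra hcon
  push Not at hcon
  have hbad : ∀ j : ℕ, ∃ (V : ℝ → EuclideanSpace ℝ (Fin 3) → EuclideanSpace ℝ (Fin 3))
      (x₀ : EuclideanSpace ℝ (Fin 3)), IsTypeIAncientMild C V ∧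
      (∀ s : ℝ, s < 0 → ∫⁻ x, ‖fderiv ℝ (V s) x‖ₑ ^ 2 ≤ ENNReal.ofReal (K / Real.sqrt (-s))) ∧
      (∀ r > 0, ∀ M : ℝ, ∃ t ∈ Ioo (-(r ^ 2)) (0 : ℝ),
        ∃ x ∈ ball (0 : EuclideanSpace ℝ (Fin 3)) r, M < ‖V t x‖) ∧ ‖x₀‖ ≤ ρ ∧
      ∀ x ∈ ball x₀ r, ‖curl (V (-1)) x‖ ≤ 1 / ((j : ℝ) + 1) := by
    intro j
    obtain ⟨V, hV, hlaw, hsing, x₀, hx₀, hno⟩ := hcon (1 / ((j : ℝ) + 1)) (by positivity)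
    exact ⟨V, x₀, hV, hlaw, hsing, hx₀, hno⟩
  choose V x₀ hV hlaw hsing hx₀ hsmall using hbad
  obtain ⟨xinf, -, φ, hφ, hxlim⟩ := (isCompact_closedBall (0 : EuclideanSpace ℝ (Fin 3)) ρ).tendsto_subseq
    (fun j => mem_closedBall_zero_iff.2 (hx₀ j))
  obtain ⟨ψ, hψ, W, hW, hunif, -, hgr⟩ := Compactness.seqLimit (w := fun j => V (φ j)) (fun j => hV _)
  have hψt : Tendsto ψ atTop atTop := hψ.tendsto_atTop
  have hWsing := Compactness.persistent_singularity_seq (w := fun j => V (φ (ψ j)))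
    (fun j => hV _) (fun j => hlaw _) (fun j => hsing _) hW hunif
  have hzero : ∀ x ∈ ball xinf r, curl (W (-1)) x = 0 := by
    intro x hx
    have h1 : Tendsto (fun j => curl (V (φ (ψ j)) (-1)) x) atTop (𝓝 (curl (W (-1)) x)) := by
      simp only [curl_eq_curlCLM]
      exact ((curlCLM : (EuclideanSpace ℝ (Fin 3) →L[ℝ] EuclideanSpace ℝ (Fin 3)) →L[ℝ]
        EuclideanSpace ℝ (Fin 3)).continuous.tendsto _).comp (hgr (-1) (by norm_num) x)
    have hxlim' : Tendsto (fun j => x₀ (φ (ψ j))) atTop (𝓝 xinf) := hxlim.comp hψt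
    have hxr : dist x xinf < r := mem_ball.1 hx
    have hxev : ∀ᶠ j in atTop, x ∈ ball (x₀ (φ (ψ j))) r := by
      have hd : ∀ᶠ j in atTop, dist (x₀ (φ (ψ j))) xinf < r - dist x xinf :=
        Metric.tendsto_nhds.1 hxlim' _ (by linarith)
      filter_upwards [hd] with j hj
      rw [mem_ball]
      calc dist x (x₀ (φ (ψ j))) ≤ dist x xinf + dist xinf (x₀ (φ (ψ j))) := dist_triangle _ _ _
        _ = dist x xinf + dist (x₀ (φ (ψ j))) xinf := by rw [dist_comm xinf]
        _ < r := by linarith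
    have hφψ : Tendsto (fun j => φ (ψ j)) atTop atTop := hφ.tendsto_atTop.comp hψt
    have hεj : Tendsto (fun j => 1 / (((φ (ψ j) : ℕ) : ℝ) + 1)) atTop (𝓝 0) :=
      tendsto_one_div_add_atTop_nhds_zero_nat.comp hφψ
    have hle : ‖curl (W (-1)) x‖ ≤ 0 :=
      le_of_tendsto_of_tendsto h1.norm hεj (hxev.mono fun j hj => hsmall (φ (ψ j)) x hj)
    exact norm_le_zero_iff.1 hle
  have hW0 := eq_zero_of_curl_eq_zero_on_open hW (s := -1) (by norm_num) isOpen_ball ⟨xinf, mem_ball_self hr⟩ hzero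
  obtain ⟨t, ht, x, -, hM⟩ := hWsing 1 one_pos 0
  rw [hW0 t ht.2 x, norm_zero] at hM
  exact lt_irrefl _ hM

/-- **THE DENSE VORTICITY FLOOR AT EVERY INSTANT (crux frame)**: for all `C, K, ρ, r > 0` a `δ > 0` such that for
every singular member of `𝒟_{C,K}`, every `t < 0` and every `‖x₀‖ ≤ ρ√(−t)`, some `x ∈ B(x₀, r√(−t))` has
`(−t)‖curl W(t, x)‖ > δ`. [cite: KochNadirashviliSereginSverak2009, §4 (arXiv:0709.3599 p. 8)] -/
theorem curl_floor_dense (C K : ℝ) {ρ r : ℝ} (hr : 0 < r) :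
    ∃ δ : ℝ, 0 < δ ∧
    ∀ (V : ℝ → EuclideanSpace ℝ (Fin 3) → EuclideanSpace ℝ (Fin 3)), IsTypeIAncientMild C V →
      (∀ s : ℝ, s < 0 → ∫⁻ x, ‖fderiv ℝ (V s) x‖ₑ ^ 2 ≤ ENNReal.ofReal (K / Real.sqrt (-s))) →
      (∀ r > 0, ∀ M : ℝ, ∃ t ∈ Ioo (-(r ^ 2)) (0 : ℝ),
        ∃ x ∈ ball (0 : EuclideanSpace ℝ (Fin 3)) r, M < ‖V t x‖) →
      ∀ t : ℝ, t < 0 → ∀ x₀ : EuclideanSpace ℝ (Fin 3), ‖x₀‖ ≤ ρ * Real.sqrt (-t) →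
        ∃ x ∈ ball x₀ (r * Real.sqrt (-t)), δ < (-t) * ‖curl (V t) x‖ := by
  obtain ⟨δ, hδ, h⟩ := curl_floor_unit C K (ρ := ρ) hr
  refine ⟨δ, hδ, fun V hV hlaw hsing t ht x₀ hx₀ => ?_⟩
  set c : ℝ := Real.sqrt (-t) with hcdef
  have hc : 0 < c := Real.sqrt_pos.2 (neg_pos.2 ht)
  have hc2 : c ^ 2 * (-1) = t := by rw [hcdef, Real.sq_sqrt (neg_pos.2 ht).le]; ring
  have hcc : c * c = -t := by rw [hcdef, Real.mul_self_sqrt (neg_pos.2 ht).le]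
  have hx₀' : ‖c⁻¹ • x₀‖ ≤ ρ := by
    rw [norm_smul, norm_inv, Real.norm_of_nonneg hc.le, inv_mul_le_iff₀ hc, mul_comm]
    exact hx₀
  obtain ⟨x, hx, hδx⟩ := h (nsRescale c V) (hV.nsRescale hc) (dissipationLaw_nsRescale hlaw hc)
    (singularAtOrigin_nsRescale hsing hc) (c⁻¹ • x₀) hx₀'
  refine ⟨c • x, ?_, ?_⟩
  · rw [mem_ball, dist_eq_norm] at hx ⊢
    have e : c • x - x₀ = c • (x - c⁻¹ • x₀) := by
      rw [smul_sub, smul_smul, mul_inv_cancel₀ hc.ne', one_smul]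
    rw [e, norm_smul, Real.norm_of_nonneg hc.le]
    calc c * ‖x - c⁻¹ • x₀‖ < c * r := mul_lt_mul_of_pos_left hx hc
      _ = r * c := mul_comm _ _
  · have hcurl : curl (nsRescale c V (-1)) x = (c * c) • curl (V (c ^ 2 * (-1))) (c • x) := by
      rw [curl_eq_curlCLM, fderiv_nsRescale, map_smul, ← curl_eq_curlCLM]
    rw [hcurl, hc2, norm_smul, Real.norm_of_nonneg (by positivity : (0 : ℝ) ≤ c * c), hcc] at hδx
    exact hδx

/-- **THE DENSE VORTICITY FLOOR ON THE ENVELOPED CLASS (law-free).**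
[cite: KochNadirashviliSereginSverak2009, §4 (arXiv:0709.3599 p. 8)] -/
theorem curl_floor_dense_envelope (A : ℝ) {ρ r : ℝ} (hr : 0 < r) :
    ∃ δ : ℝ, 0 < δ ∧
    ∀ (C : ℝ) (V : ℝ → EuclideanSpace ℝ (Fin 3) → EuclideanSpace ℝ (Fin 3)), IsTypeIAncientMild C V → C ≤ A →
      HasTypeIDecay A V →
      (∀ r > 0, ∀ M : ℝ, ∃ t ∈ Ioo (-(r ^ 2)) (0 : ℝ),
        ∃ x ∈ ball (0 : EuclideanSpace ℝ (Fin 3)) r, M < ‖V t x‖) →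
      ∀ t : ℝ, t < 0 → ∀ x₀ : EuclideanSpace ℝ (Fin 3), ‖x₀‖ ≤ ρ * Real.sqrt (-t) →
        ∃ x ∈ ball x₀ (r * Real.sqrt (-t)), δ < (-t) * ‖curl (V t) x‖ := by
  obtain ⟨K, hK⟩ := LambProduct.exists_uniform_law_of_envelope A
  obtain ⟨δ, hδ, h⟩ := curl_floor_dense A K (ρ := ρ) hr
  exact ⟨δ, hδ, fun C V hV hCA hdec hsing => h V (isTypeIAncientMild_of_le hV hCA)
    (hK (isTypeIAncientMild_of_le hV hCA) hdec) hsing⟩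

end Vorticity

/-! ### The dense planarity floor, uniformly over the unit directions -/

section Planarity

/-- **THE DENSE PLANARITY FLOOR AT THE UNIT SLICE, UNIFORM OVER UNIT DIRECTIONS (crux frame).**
[cite: KochNadirashviliSereginSverak2009, §4 (arXiv:0709.3599 p. 8)] -/
theorem fderiv_apply_floor_unit (C K : ℝ) {ρ r : ℝ} (hr : 0 < r) :
    ∃ δ : ℝ, 0 < δ ∧
    ∀ (V : ℝ → EuclideanSpace ℝ (Fin 3) → EuclideanSpace ℝ (Fin 3)), IsTypeIAncientMild C V →
      (∀ s : ℝ, s < 0 → ∫⁻ x, ‖fderiv ℝ (V s) x‖ₑ ^ 2 ≤ ENNReal.ofReal (K / Real.sqrt (-s))) →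
      (∀ r > 0, ∀ M : ℝ, ∃ t ∈ Ioo (-(r ^ 2)) (0 : ℝ),
        ∃ x ∈ ball (0 : EuclideanSpace ℝ (Fin 3)) r, M < ‖V t x‖) →
      ∀ e : EuclideanSpace ℝ (Fin 3), ‖e‖ = 1 → ∀ x₀ : EuclideanSpace ℝ (Fin 3), ‖x₀‖ ≤ ρ →
        ∃ x ∈ ball x₀ r, δ < ‖fderiv ℝ (V (-1)) x e‖ := by
  by_contra hcon
  push Not at hcon
  have hbad : ∀ j : ℕ, ∃ (V : ℝ → EuclideanSpace ℝ (Fin 3) → EuclideanSpace ℝ (Fin 3))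
      (e x₀ : EuclideanSpace ℝ (Fin 3)), IsTypeIAncientMild C V ∧
      (∀ s : ℝ, s < 0 → ∫⁻ x, ‖fderiv ℝ (V s) x‖ₑ ^ 2 ≤ ENNReal.ofReal (K / Real.sqrt (-s))) ∧
      (∀ r > 0, ∀ M : ℝ, ∃ t ∈ Ioo (-(r ^ 2)) (0 : ℝ),
        ∃ x ∈ ball (0 : EuclideanSpace ℝ (Fin 3)) r, M < ‖V t x‖) ∧ ‖e‖ = 1 ∧ ‖x₀‖ ≤ ρ ∧
      ∀ x ∈ ball x₀ r, ‖fderiv ℝ (V (-1)) x e‖ ≤ 1 / ((j : ℝ) + 1) := by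
    intro j
    obtain ⟨V, hV, hlaw, hsing, e, he, x₀, hx₀, hno⟩ := hcon (1 / ((j : ℝ) + 1)) (by positivity)
    exact ⟨V, e, x₀, hV, hlaw, hsing, he, hx₀, hno⟩
  choose V e x₀ hV hlaw hsing he hx₀ hsmall using hbad
  -- convergent directions, then convergent centres, then the KNSS limit
  obtain ⟨einf, heinf, φ₁, hφ₁, helim⟩ := (isCompact_sphere (0 : EuclideanSpace ℝ (Fin 3)) 1).tendsto_subseq
    (fun j => mem_sphere_zero_iff_norm.2 (he j))
  obtain ⟨xinf, -, φ₂, hφ₂, hxlim⟩ := (isCompact_closedBall (0 : EuclideanSpace ℝ (Fin 3)) ρ).tendsto_subseq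
    (fun j => mem_closedBall_zero_iff.2 (hx₀ (φ₁ j)))
  obtain ⟨ψ, hψ, W, hW, hunif, -, hgr⟩ :=
    Compactness.seqLimit (w := fun j => V (φ₁ (φ₂ j))) (fun j => hV _)
  have hψt : Tendsto ψ atTop atTop := hψ.tendsto_atTop
  have hφ₂t : Tendsto φ₂ atTop atTop := hφ₂.tendsto_atTop
  have hWsing := Compactness.persistent_singularity_seq (w := fun j => V (φ₁ (φ₂ (ψ j))))
    (fun j => hV _) (fun j => hlaw _) (fun j => hsing _) hW hunif
  have heinf0 : einf ≠ 0 := by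
    intro h0
    have : ‖einf‖ = 1 := mem_sphere_zero_iff_norm.1 heinf
    rw [h0, norm_zero] at this
    exact zero_ne_one this
  have hzero : ∀ x ∈ ball xinf r, fderiv ℝ (W (-1)) x einf = 0 := by
    intro x hx
    have hL : Tendsto (fun j => fderiv ℝ (V (φ₁ (φ₂ (ψ j))) (-1)) x) atTop (𝓝 (fderiv ℝ (W (-1)) x)) :=
      hgr (-1) (by norm_num) x
    have hE : Tendsto (fun j => e (φ₁ (φ₂ (ψ j)))) atTop (𝓝 einf) := helim.comp (hφ₂t.comp hψt)
    have h1 : Tendsto (fun j => fderiv ℝ (V (φ₁ (φ₂ (ψ j))) (-1)) x (e (φ₁ (φ₂ (ψ j))))) atTop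
        (𝓝 (fderiv ℝ (W (-1)) x einf)) := WindowRecurrence.tendsto_clm_apply_filter hL hE
    have hxlim' : Tendsto (fun j => x₀ (φ₁ (φ₂ (ψ j)))) atTop (𝓝 xinf) := hxlim.comp hψt
    have hxr : dist x xinf < r := mem_ball.1 hx
    have hxev : ∀ᶠ j in atTop, x ∈ ball (x₀ (φ₁ (φ₂ (ψ j)))) r := by
      have hd : ∀ᶠ j in atTop, dist (x₀ (φ₁ (φ₂ (ψ j)))) xinf < r - dist x xinf :=
        Metric.tendsto_nhds.1 hxlim' _ (by linarith)
      filter_upwards [hd] with j hj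
      rw [mem_ball]
      calc dist x (x₀ (φ₁ (φ₂ (ψ j)))) ≤ dist x xinf + dist xinf (x₀ (φ₁ (φ₂ (ψ j)))) := dist_triangle _ _ _
        _ = dist x xinf + dist (x₀ (φ₁ (φ₂ (ψ j)))) xinf := by rw [dist_comm xinf]
        _ < r := by linarith
    have hidx : Tendsto (fun j => φ₁ (φ₂ (ψ j))) atTop atTop := hφ₁.tendsto_atTop.comp (hφ₂t.comp hψt)
    have hεj : Tendsto (fun j => 1 / (((φ₁ (φ₂ (ψ j)) : ℕ) : ℝ) + 1)) atTop (𝓝 0) :=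
      tendsto_one_div_add_atTop_nhds_zero_nat.comp hidx
    have hle : ‖fderiv ℝ (W (-1)) x einf‖ ≤ 0 :=
      le_of_tendsto_of_tendsto h1.norm hεj (hxev.mono fun j hj => hsmall (φ₁ (φ₂ (ψ j))) x hj)
    exact norm_le_zero_iff.1 hle
  have hW0 := eq_zero_of_fderiv_apply_eq_zero_on_open hW (s := -1) (by norm_num) heinf0 isOpen_ball
    ⟨xinf, mem_ball_self hr⟩ hzero
  obtain ⟨t, ht, x, -, hM⟩ := hWsing 1 one_pos 0
  rw [hW0 t ht.2 x, norm_zero] at hM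
  exact lt_irrefl _ hM

/-- **THE DENSE PLANARITY FLOOR AT EVERY INSTANT, EVERY UNIT DIRECTION (crux frame)**: for all `C, K, ρ, r > 0` a
`δ > 0` such that for every singular member of `𝒟_{C,K}`, every `t < 0`, every unit vector `e` and every
`‖x₀‖ ≤ ρ√(−t)`, some `x ∈ B(x₀, r√(−t))` has `(−t)‖D(W t)(x) e‖ > δ`.
[cite: KochNadirashviliSereginSverak2009, §4 (arXiv:0709.3599 p. 8)] -/
theorem fderiv_apply_floor_dense (C K : ℝ) {ρ r : ℝ} (hr : 0 < r) :
    ∃ δ : ℝ, 0 < δ ∧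
    ∀ (V : ℝ → EuclideanSpace ℝ (Fin 3) → EuclideanSpace ℝ (Fin 3)), IsTypeIAncientMild C V →
      (∀ s : ℝ, s < 0 → ∫⁻ x, ‖fderiv ℝ (V s) x‖ₑ ^ 2 ≤ ENNReal.ofReal (K / Real.sqrt (-s))) →
      (∀ r > 0, ∀ M : ℝ, ∃ t ∈ Ioo (-(r ^ 2)) (0 : ℝ),
        ∃ x ∈ ball (0 : EuclideanSpace ℝ (Fin 3)) r, M < ‖V t x‖) →
      ∀ t : ℝ, t < 0 → ∀ e : EuclideanSpace ℝ (Fin 3), ‖e‖ = 1 →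
        ∀ x₀ : EuclideanSpace ℝ (Fin 3), ‖x₀‖ ≤ ρ * Real.sqrt (-t) →
          ∃ x ∈ ball x₀ (r * Real.sqrt (-t)), δ < (-t) * ‖fderiv ℝ (V t) x e‖ := by
  obtain ⟨δ, hδ, h⟩ := fderiv_apply_floor_unit C K (ρ := ρ) hr
  refine ⟨δ, hδ, fun V hV hlaw hsing t ht e he x₀ hx₀ => ?_⟩
  set c : ℝ := Real.sqrt (-t) with hcdef
  have hc : 0 < c := Real.sqrt_pos.2 (neg_pos.2 ht)
  have hc2 : c ^ 2 * (-1) = t := by rw [hcdef, Real.sq_sqrt (neg_pos.2 ht).le]; ring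
  have hcc : c * c = -t := by rw [hcdef, Real.mul_self_sqrt (neg_pos.2 ht).le]
  have hx₀' : ‖c⁻¹ • x₀‖ ≤ ρ := by
    rw [norm_smul, norm_inv, Real.norm_of_nonneg hc.le, inv_mul_le_iff₀ hc, mul_comm]
    exact hx₀
  obtain ⟨x, hx, hδx⟩ := h (nsRescale c V) (hV.nsRescale hc) (dissipationLaw_nsRescale hlaw hc)
    (singularAtOrigin_nsRescale hsing hc) e he (c⁻¹ • x₀) hx₀'
  refine ⟨c • x, ?_, ?_⟩
  · rw [mem_ball, dist_eq_norm] at hx ⊢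
    have e1 : c • x - x₀ = c • (x - c⁻¹ • x₀) := by
      rw [smul_sub, smul_smul, mul_inv_cancel₀ hc.ne', one_smul]
    rw [e1, norm_smul, Real.norm_of_nonneg hc.le]
    calc c * ‖x - c⁻¹ • x₀‖ < c * r := mul_lt_mul_of_pos_left hx hc
      _ = r * c := mul_comm _ _
  · rw [fderiv_nsRescale, hc2, _root_.smul_apply, norm_smul,
      Real.norm_of_nonneg (by positivity : (0 : ℝ) ≤ c * c), hcc] at hδx
    exact hδx

/-- **THE DENSE PLANARITY FLOOR ON THE ENVELOPED CLASS (law-free).**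
[cite: KochNadirashviliSereginSverak2009, §4 (arXiv:0709.3599 p. 8)] -/
theorem fderiv_apply_floor_dense_envelope (A : ℝ) {ρ r : ℝ} (hr : 0 < r) :
    ∃ δ : ℝ, 0 < δ ∧
    ∀ (C : ℝ) (V : ℝ → EuclideanSpace ℝ (Fin 3) → EuclideanSpace ℝ (Fin 3)), IsTypeIAncientMild C V → C ≤ A →
      HasTypeIDecay A V →
      (∀ r > 0, ∀ M : ℝ, ∃ t ∈ Ioo (-(r ^ 2)) (0 : ℝ),
        ∃ x ∈ ball (0 : EuclideanSpace ℝ (Fin 3)) r, M < ‖V t x‖) →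
      ∀ t : ℝ, t < 0 → ∀ e : EuclideanSpace ℝ (Fin 3), ‖e‖ = 1 →
        ∀ x₀ : EuclideanSpace ℝ (Fin 3), ‖x₀‖ ≤ ρ * Real.sqrt (-t) →
          ∃ x ∈ ball x₀ (r * Real.sqrt (-t)), δ < (-t) * ‖fderiv ℝ (V t) x e‖ := by
  obtain ⟨K, hK⟩ := LambProduct.exists_uniform_law_of_envelope A
  obtain ⟨δ, hδ, h⟩ := fderiv_apply_floor_dense A K (ρ := ρ) hr
  exact ⟨δ, hδ, fun C V hV hCA hdec hsing => h V (isTypeIAncientMild_of_le hV hCA)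
    (hK (isTypeIAncientMild_of_le hV hCA) hdec) hsing⟩

end Planarity

end Summit.NavierStokesRegularity.NavierStokesRegularity.Theorems.FiniteDissipationLiouville.DenseFloors

end
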